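import Mathlib
import Literature.NumberTheory.Transcendental.SemialgebraicMapsProofs
import Literature.NumberTheory.Transcendental.SemialgebraicVolume
import Literature.ModelTheory.ExponentialFields.SemialgebraicInterior
import Literature.NumberTheory.Transcendental.KZMonomialCompression
import Summits.KontsevichZagierPeriods.KontsevichZagierPeriods.Theorems.SymplecticScissorsPlanarSAZylevStubTeCalc

/-!
# Crux `SymplecticScissors.PlanarSAZylev` (stmt-KontsevichZagierPeriods-9848),
line `reservoir-peeling`, stub `stub_downset`: compression of finite-area down-sets

The pinned relation `E A B` says: an open co-null `ℚ`-semialgebraic part `U` of `A` is carried by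
one `ℚ`-semialgebraic `C¹` injection `Φ` with `|det DΦ| = 1` onto a co-null part of `B`.  We prove
that a finite-area `ℚ`-semialgebraic coordinatewise down-set `D` of the open positive quadrant is
`E`-equivalent to a BOUNDED `ℚ`-semialgebraic region.

The map is the *rescaled monomial compression* `Ψ := diag(q^m, 1, …, 1) ∘ Φ` of
`Literature/NumberTheory/Transcendental/KZMonomialCompression.lean`
(`Φ(x)ⱼ = xⱼ^η (∏ᵢ xᵢ)^β = exp (η log xⱼ + β ∑ᵢ log xᵢ)`, `η = 1/q`, `β = (q-1)/(q(m+1))`, `q` a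
large integer), written for the open orthant of `ℝ^{m+1}` and specialised to `m = 1` at the end
(`downset_rescaledCompression`):

* `Φ` is a `ℚ`-semialgebraic map on the orthant (`KZ.isSemialgebraicMapOn_monomialCompression`),
  and so is the rational diagonal matrix, hence `Ψ` (composition of semialgebraic maps);
* `Φ` is smooth on the orthant (`exp`, `log`, finite sums; `downset_contDiffAt_compression`), the
  diagonal matrix is linear, hence `Ψ` is `C¹`;
* `Φ` is injective on the orthant (`KZ.injOn_monomialCompression`), the diagonal matrix is
  injective;
* the Jacobian determinant of `Φ` is the constant `η^m` (`KZ.det_fderiv_monomialCompression`),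
  that of `diag(q^m, 1, …, 1)` is `q^m`, so `|det DΨ| = (q η)^m = 1` (chain rule,
  multiplicativity of `det`);
* `Φ '' D` lies in a box by the polynomial box decay of finite-volume down-sets
  (`DownSetTail.exists_prod_le_mul_rpow`, `KZ.monomialCompression_le`), and a continuous linear
  map is Lipschitz, so `Ψ '' D` is bounded.

Finally (`stub_downset`) the witness of `E D (Ψ '' D)` is the restriction of `Ψ` to the interior
of `D` (`teCalc_restrict` of the landed file `…StubTeCalc` of stub `stub_teCalc`: the frontier of
a semialgebraic set is null and `C¹` maps send null sets to null sets), and `Ψ '' D` is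
`ℚ`-semialgebraic as the image of a semialgebraic set under a semialgebraic map.

Sources: J. Viu-Sos, *A semi-canonical reduction for periods of Kontsevich–Zagier*,
Int. J. Number Theory 17 (2021), Thm. 1.1 (the tree replaces its step Cor. 2.2 by the monomial
compression); M. Kontsevich, D. Zagier, *Periods* (2001), §1.2.  Everything here is bookkeeping
around the proved literature file `KZMonomialCompression.lean`; no new definitions.
-/

noncomputable section

open MeasureTheory Set
open Literature.NumberTheory.Transcendental Literature.ModelTheory.ExponentialFields

namespace Summit.KontsevichZagierPeriods.SymplecticScissors.PlanarSAZylev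

/-- The open positive orthant `{x | ∀ i, 0 < xᵢ}` of `ℝ^{m+1}` is `ℚ`-semialgebraic (a finite
intersection of the basic open sets `{0 < Xᵢ}`). [folklore] -/
theorem downset_isSemialgebraic_orthant {m : ℕ} :
    IsSemialgebraic ℚ {x : Fin (m + 1) → ℝ | ∀ i, 0 < x i} := by
  have h : {x : Fin (m + 1) → ℝ | ∀ i, 0 < x i} = ⋂ i ∈ (Finset.univ : Finset (Fin (m + 1))),
      {x : Fin (m + 1) → ℝ |
        0 < MvPolynomial.aeval x (MvPolynomial.X i : MvPolynomial (Fin (m + 1)) ℚ)} := by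
    ext x
    simp
  rw [h]
  exact IsSemialgebraic.biInter _ _ fun i _ => isSemialgebraic_setOf_eval_pos _

/-- The monomial compression `x ↦ (exp (η log xⱼ + β ∑ᵢ log xᵢ))ⱼ` is smooth at every point of
the open positive orthant (`exp`, `log` away from `0`, finite sums). [folklore] -/
theorem downset_contDiffAt_compression {m : ℕ} {n : WithTop ℕ∞} (η β : ℝ) {x : Fin (m + 1) → ℝ}
    (hx : ∀ i, 0 < x i) :
    ContDiffAt ℝ n (fun (x : Fin (m + 1) → ℝ) (j : Fin (m + 1)) =>
      Real.exp (η * Real.log (x j) + β * ∑ i, Real.log (x i))) x := by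
  have hlog : ∀ i : Fin (m + 1),
      ContDiffAt ℝ n (fun y : Fin (m + 1) → ℝ => Real.log (y i)) x := fun i =>
    (contDiffAt_apply ℝ ℝ (n := n) i x).log (hx i).ne'
  exact contDiffAt_pi.2 fun j =>
    ((contDiffAt_const.mul (hlog j)).add
      (contDiffAt_const.mul (ContDiffAt.sum fun i _ => hlog i))).exp

/-- The determinant of a composite of continuous linear endomorphisms of `ℝ^k` is the product of
the determinants. [folklore] -/
theorem downset_det_comp {k : ℕ} (A B : (Fin k → ℝ) →L[ℝ] (Fin k → ℝ)) :
    (A.comp B).det = A.det * B.det := by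
  rw [ContinuousLinearMap.det, ContinuousLinearMap.toLinearMap_comp, LinearMap.det_comp]

/-- **The rescaled monomial compression.** Let `D ⊆ (0, ∞)^{m+1}` be a `ℚ`-semialgebraic
coordinatewise down-set of finite volume.  Then there is a map `Ψ` of `ℝ^{m+1}` which, on the
open positive orthant `O`, is a `ℚ`-semialgebraic `C¹` injection with `|det DΨ| = 1` everywhere,
and such that `Ψ '' D` is bounded: `Ψ = diag(q^m, 1, …, 1) ∘ Φ` with `Φ` the monomial
compression `Φ(x)ⱼ = xⱼ^η (∏ xᵢ)^β`, `η = 1/q`, `β = (q-1)/(q(m+1))`, `q` large in terms of the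
decay exponent of `DownSetTail.exists_prod_le_mul_rpow` (constant Jacobian `η^m`, bounded image
by `KZ.monomialCompression_le`).
[cite: ViuSos2021, Thm. 1.1 (step Cor. 2.2, replaced)] -/
theorem downset_rescaledCompression {m : ℕ} {D : Set (Fin (m + 1) → ℝ)}
    (hD : IsSemialgebraic ℚ D) (hfin : volume D ≠ ⊤) (hpos : ∀ x ∈ D, ∀ i, 0 < x i)
    (hdown : ∀ x ∈ D, ∀ y : Fin (m + 1) → ℝ, (∀ i, 0 < y i ∧ y i ≤ x i) → y ∈ D) :
    ∃ Ψ : (Fin (m + 1) → ℝ) → (Fin (m + 1) → ℝ),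
      IsSemialgebraicMapOn ℚ {x : Fin (m + 1) → ℝ | ∀ i, 0 < x i} Ψ ∧
      ContDiffOn ℝ 1 Ψ {x : Fin (m + 1) → ℝ | ∀ i, 0 < x i} ∧
      InjOn Ψ {x : Fin (m + 1) → ℝ | ∀ i, 0 < x i} ∧
      (∀ p ∈ {x : Fin (m + 1) → ℝ | ∀ i, 0 < x i}, |(fderiv ℝ Ψ p).det| = 1) ∧
      Bornology.IsBounded (Ψ '' D) := by
  -- adapted from `KZ.exists_isBounded_of_downset` (KZMonomialCompression.lean)
  classical
  -- polynomial box decay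
  obtain ⟨C, α, hC, hα, hdecay⟩ := DownSetTail.exists_prod_le_mul_rpow hD hpos hdown hfin
  -- the exponents
  set q : ℕ := ⌈(m + 1 : ℝ) / α⌉₊ + 2 with hq
  have hq1 : 1 ≤ q := by omega
  have hqR : (q : ℝ) = ⌈(m + 1 : ℝ) / α⌉₊ + 2 := by rw [hq]; push_cast; ring
  have hq0 : (0 : ℝ) < q := by rw [hqR]; positivity
  have hqα : (m + 1 : ℝ) ≤ α * (q - 1) := by
    have h1 : (m + 1 : ℝ) / α ≤ ⌈(m + 1 : ℝ) / α⌉₊ := Nat.le_ceil _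
    have h2 : (m + 1 : ℝ) = α * ((m + 1 : ℝ) / α) := by field_simp
    rw [h2, hqR]
    exact mul_le_mul_of_nonneg_left (by linarith) hα.le
  set η : ℝ := 1 / q with hη
  set β : ℝ := (q - 1) / (q * (m + 1)) with hβ
  have hηpos : 0 < η := by rw [hη]; positivity
  have hβpos : 0 ≤ β := by
    rw [hβ]
    apply div_nonneg
    · have : (1 : ℝ) ≤ q := by exact_mod_cast hq1
      linarith
    · positivity
  have hηβ : η + (m + 1) * β = 1 := by
    rw [hη, hβ]
    field_simp
    ring
  have hαβ : η ≤ α * β := by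
    rw [hη, hβ, div_le_iff₀ hq0]
    have : α * ((↑q - 1) / (↑q * (↑m + 1))) * ↑q = α * (q - 1) / (m + 1) := by
      field_simp
    rw [this, le_div_iff₀ (by positivity)]
    linarith
  -- the compression on the open orthant `O`
  set O : Set (Fin (m + 1) → ℝ) := {x | ∀ i, 0 < x i} with hO
  have hOsa : IsSemialgebraic ℚ O := downset_isSemialgebraic_orthant
  have hsa := KZ.isSemialgebraicMapOn_monomialCompression q hq1 η β hη hβ hOsa fun x hx => hx
  set Φ : (Fin (m + 1) → ℝ) → (Fin (m + 1) → ℝ) := fun x j =>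
    Real.exp (η * Real.log (x j) + β * ∑ i, Real.log (x i)) with hΦ
  set M : ℝ := max 1 (Real.exp (β * Real.log C)) with hM
  have hbox : Φ '' D ⊆ Icc (fun _ => 0) (fun _ => M) := by
    rintro _ ⟨x, hx, rfl⟩
    exact ⟨fun j => (Real.exp_pos _).le, fun j =>
      KZ.monomialCompression_le η β α C hηpos.le hβpos hαβ hC (hpos x hx) (hdecay x hx) j⟩
  have hTb : Bornology.IsBounded (Φ '' D) := (Metric.isBounded_Icc _ _).subset hbox
  have hΦC1 : ContDiffOn ℝ 1 Φ O := fun x hx =>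
    (downset_contDiffAt_compression η β hx).contDiffWithinAt
  -- the linear rescaling `diag(q^m, 1, …, 1)`
  set d : Fin (m + 1) → ℚ := fun i => if i = 0 then (q : ℚ) ^ m else 1 with hd
  have hdR : ∀ i, (d i : ℝ) = if i = 0 then (q : ℝ) ^ m else 1 := fun i => by
    simp only [hd]
    split_ifs <;> simp
  have hd0 : ∀ i, (d i : ℝ) ≠ 0 := fun i => by
    rw [hdR]
    split_ifs
    · exact pow_ne_zero m hq0.ne'
    · norm_num
  set L : (Fin (m + 1) → ℝ) →L[ℝ] (Fin (m + 1) → ℝ) :=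
    LinearMap.toContinuousLinearMap (Matrix.toLin' (Matrix.diagonal fun i => (d i : ℝ))) with hL
  have hLapply : ∀ x i, L x i = (d i : ℝ) * x i := fun x i => by
    rw [hL, LinearMap.coe_toContinuousLinearMap', Matrix.toLin'_apply, Matrix.mulVec_diagonal]
  have hLdet : L.det = (q : ℝ) ^ m := by
    rw [ContinuousLinearMap.det, hL]
    simp only [LinearMap.coe_toContinuousLinearMap]
    rw [LinearMap.det_toLin', Matrix.det_diagonal]
    simp_rw [hdR]
    rw [Finset.prod_ite_eq']
    simp
  have hLsa : IsSemialgebraicMapOn ℚ (univ : Set (Fin (m + 1) → ℝ)) L := by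
    refine (isSemialgebraicMapOn_aeval isSemialgebraic_univ
      fun j => MvPolynomial.C (d j) * MvPolynomial.X j).congr fun x _ => ?_
    funext j
    rw [hLapply]
    simp
  have hLinj : Function.Injective L := by
    intro x y hxy
    funext i
    have := congr_fun hxy i
    rw [hLapply, hLapply] at this
    exact mul_left_cancel₀ (hd0 i) this
  refine ⟨L ∘ Φ, hLsa.comp_holds hsa (mapsTo_univ _ _), L.contDiff.comp_contDiffOn hΦC1,
    hLinj.comp_injOn (KZ.injOn_monomialCompression η β hηpos.ne' hηβ), fun p hp => ?_, ?_⟩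
  · -- chain rule and multiplicativity of the determinant
    rw [(L.hasFDerivAt.comp p (KZ.hasFDerivAt_monomialCompression η β hp)).fderiv,
      downset_det_comp, hLdet, KZ.det_fderiv_monomialCompression η β hηpos.ne' hηβ hp, ← mul_pow,
      hη, mul_one_div_cancel hq0.ne', one_pow, abs_one]
  · rw [image_comp]
    exact L.lipschitz.isBounded_image hTb

/-- **Compression of down-sets** (stub `stub_downset`): a finite-area `ℚ`-semialgebraic down-set
of the open quadrant is equivalent to a BOUNDED `ℚ`-region — the monomial compression
`Φ(x)ⱼ = xⱼ^η (x₀x₁)^β` of `KZMonomialCompression.lean` (constant Jacobian `η`, bounded image by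
`DownSetTail.exists_prod_le_mul_rpow`) followed by `diag(1/η, 1)`. [cite: ViuSos2021, Thm. 1.1
(step Cor. 2.2, replaced)] -/
theorem stub_downset :
    ∀ (E : Set (Fin 2 → ℝ) → Set (Fin 2 → ℝ) → Prop),
      (∀ A B : Set (Fin 2 → ℝ), E A B ↔
        ∃ (U : Set (Fin 2 → ℝ)) (Φ : (Fin 2 → ℝ) → (Fin 2 → ℝ)),
          U ⊆ A ∧ IsSemialgebraic ℚ U ∧ IsOpen U ∧ volume (A \ U) = 0 ∧
          IsSemialgebraicMapOn ℚ U Φ ∧ ContDiffOn ℝ 1 Φ U ∧ InjOn Φ U ∧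
          (∀ p ∈ U, |(fderiv ℝ Φ p).det| = 1) ∧ Φ '' U ⊆ B ∧ volume (B \ Φ '' U) = 0) →
    ∀ D : Set (Fin 2 → ℝ), IsSemialgebraic ℚ D → volume D ≠ ⊤ →
      (∀ x ∈ D, ∀ i, 0 < x i) →
      (∀ x ∈ D, ∀ y : Fin 2 → ℝ, (∀ i, 0 < y i ∧ y i ≤ x i) → y ∈ D) →
      ∃ B : Set (Fin 2 → ℝ), IsSemialgebraic ℚ B ∧ Bornology.IsBounded B ∧ E D B := by
  intro E HE D hD hfin hpos hdown
  obtain ⟨Ψ, hΨsa, hΨC1, hΨinj, hΨdet, hΨb⟩ :=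
    downset_rescaledCompression (m := 1) hD hfin hpos hdown
  have hDO : D ⊆ {x : Fin 2 → ℝ | ∀ i, 0 < x i} := fun x hx => hpos x hx
  exact ⟨Ψ '' D, hΨsa.isSemialgebraic_image_holds hDO hD, hΨb,
    (HE D (Ψ '' D)).2 (teCalc_restrict hΨsa hΨC1 hΨinj hΨdet hDO hD)⟩

end Summit.KontsevichZagierPeriods.SymplecticScissors.PlanarSAZylev
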